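import Literature.Analysis.OperatorTheory.ExpInnerProductKernelPositivity

/-!
# Crux `DiagonalMirrorRPR` (stmt-QuantumFields-10604), line `sign-twisted-diagonal-trace`, construction F1_diag
# (director-ym O4 WORD 3 (A)), operator layer, step S1: the EXPONENTIAL FEATURE LIFT
# `exp(β⟨w, w′⟩) = Σ_q φ_q(w) φ_q(w′)` with explicit real features

Helper for the crux `DiagonalMirrorRPR` of `YangMills` (routes `IsotropyFromPowerCounting`, `MirrorModularBoosts`,
`PencilRigidity`; item stmt-QuantumFields-10604), attached `--supports … --as helper`; it closes nothing by itself.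
Pure real analysis (Mathlib + `Literature/Analysis/OperatorTheory/ExpInnerProductKernelPositivity` for the multinomial identity
`sum_mul_pow_eq_sum_prod`); it is the first step of the FEATURE-LIFT realisation of the Wilson diagonal transfer operator
(ROADMAP-F1diag v2 §1½ on the item): with `…WilsonDiagonalModelSchurCut.evenActionU_thetaHalf_eq_sum_feature`
(`even(Y, X, ΘY″) = ⟨w(Y″), w(Y)⟩ + inslab(X)`) it writes the Θ-twisted even half step as `Ê = Φ† Φ` for the explicit
ℓ²-valued map `Φ`, so that the self-adjoint realisation `Φ Ô Φ†` of the two-step operator `K_u = Ê Ô` is an honest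
square-integrable symmetric kernel on (feature index) × (in-slab half layer) — the setting of the tree's `L²`-kernel
Hilbert–Schmidt package (`Literature/Analysis/OperatorTheory/L2Kernel{IntegralOperator,HilbertSchmidt,Pairing}`), with no
trace-class theory and no operator square root.

* `ExpIdx p = Σ n, (Fin n → Fin p)` (countable feature indices); `expFeature β ⟨n, i⟩ w = (βⁿ/n!)^{1/2} ∏_k w_{i k}`;
* `expFeature_mul_expFeature`, `sum_expFeature_mul_expFeature` (fixed degree: `(β⟨w,w′⟩)ⁿ/n!`),
  `sum_abs_expFeature_mul_expFeature`, `summable_expFeature_mul_expFeature` (absolute summability over the sigma type);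
* ★ **`hasSum_expFeature_mul_expFeature`**: `HasSum (q ↦ φ_q(w) φ_q(w′)) (exp(β Σ_j w_j w′_j))` for `β ≥ 0`;
  `hasSum_expFeature_sq` (`Σ_q φ_q(w)² = exp(β|w|²)`), `tsum_expFeature_sq_le` (`≤ exp(β p M²)` for `|w_j| ≤ M`: the
  Hilbert–Schmidt norm of the feature map), `continuous_expFeature`, `abs_expFeature_le`.

HONEST FRAMING: a construction helper (real analysis); nothing about D_old ⟨10604⟩, the RP crux of the FOLD restate, or the
summit is proved; no `def wilsonDiagonalModel` yet; the Yang–Mills mass gap is NOT proved here or anywhere in the tree.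

References: C. Berg, J. P. R. Christensen, P. Ressel, *Harmonic Analysis on Semigroups* (1984) Ch. 3 §1–2 (the exponential of
a positive definite kernel; feature/Mercer expansions); M. Reed, B. Simon, *Methods of Modern Mathematical Physics I* (1980)
Thm VI.22–23.
-/

set_option autoImplicit false

noncomputable section

open scoped BigOperators

namespace Summit.QuantumFields.YangMills.Cruxes.DiagonalMirrorRPR.SignTwistedDiagonalTrace.WilsonDiagonal

/-! ## §13 The exponential feature lift: `exp(β⟨w, w′⟩) = Σ_q φ_q(w) φ_q(w′)` with explicit real features -/

section FeatureLift

/-- Feature indices of the exponential kernel on `ℝᵖ`: a degree `n` and a multi-index `i : Fin n → Fin p`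
(a countable type). -/
abbrev ExpIdx (p : ℕ) : Type := Σ n : ℕ, (Fin n → Fin p)

variable {p : ℕ}

/-- **The exponential features** `φ_{n,i}(w) = (βⁿ/n!)^{1/2} ∏_{k<n} w_{i k}`: the explicit real feature map of the kernel
`exp(β⟨w, w′⟩)` (`hasSum_expFeature_mul`). -/
def expFeature (β : ℝ) (q : ExpIdx p) (w : Fin p → ℝ) : ℝ :=
  Real.sqrt (β ^ q.1 / (q.1.factorial : ℝ)) * ∏ k, w (q.2 k)

/-- The product of two features of the same index: `φ_q(w) φ_q(w′) = (βⁿ/n!) (∏ w_{i k}) (∏ w′_{i k})` (`β ≥ 0`). -/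
theorem expFeature_mul_expFeature {β : ℝ} (hβ : 0 ≤ β) (q : ExpIdx p) (w w' : Fin p → ℝ) :
    expFeature β q w * expFeature β q w' = β ^ q.1 / (q.1.factorial : ℝ) * ((∏ k, w (q.2 k)) * ∏ k, w' (q.2 k)) := by
  unfold expFeature
  have h0 : 0 ≤ β ^ q.1 / (q.1.factorial : ℝ) := by positivity
  calc Real.sqrt (β ^ q.1 / (q.1.factorial : ℝ)) * (∏ k, w (q.2 k)) *
        (Real.sqrt (β ^ q.1 / (q.1.factorial : ℝ)) * ∏ k, w' (q.2 k))
      = (Real.sqrt (β ^ q.1 / (q.1.factorial : ℝ)) * Real.sqrt (β ^ q.1 / (q.1.factorial : ℝ))) *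
          ((∏ k, w (q.2 k)) * ∏ k, w' (q.2 k)) := by ring
    _ = β ^ q.1 / (q.1.factorial : ℝ) * ((∏ k, w (q.2 k)) * ∏ k, w' (q.2 k)) := by rw [Real.mul_self_sqrt h0]

/-- Fixed degree: `Σ_{i : Fin n → Fin p} φ_{n,i}(w) φ_{n,i}(w′) = (β⟨w,w′⟩)ⁿ / n!`. -/
theorem sum_expFeature_mul_expFeature {β : ℝ} (hβ : 0 ≤ β) (n : ℕ) (w w' : Fin p → ℝ) :
    ∑ i : Fin n → Fin p, expFeature β ⟨n, i⟩ w * expFeature β ⟨n, i⟩ w' =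
      (β * ∑ j, w j * w' j) ^ n / (n.factorial : ℝ) := by
  simp only [expFeature_mul_expFeature hβ]
  rw [← Finset.mul_sum, ← Literature.Analysis.OperatorTheory.sum_mul_pow_eq_sum_prod, mul_pow]
  ring

/-- Fixed degree, absolute values: `Σ_i |φ_{n,i}(w) φ_{n,i}(w′)| = (β Σ_j |w_j||w′_j|)ⁿ / n!`. -/
theorem sum_abs_expFeature_mul_expFeature {β : ℝ} (hβ : 0 ≤ β) (n : ℕ) (w w' : Fin p → ℝ) :
    ∑ i : Fin n → Fin p, |expFeature β ⟨n, i⟩ w * expFeature β ⟨n, i⟩ w'| =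
      (β * ∑ j, |w j| * |w' j|) ^ n / (n.factorial : ℝ) := by
  have h : ∀ i : Fin n → Fin p, |expFeature β ⟨n, i⟩ w * expFeature β ⟨n, i⟩ w'| =
      expFeature β ⟨n, i⟩ (fun j => |w j|) * expFeature β ⟨n, i⟩ (fun j => |w' j|) := by
    intro i
    rw [expFeature_mul_expFeature hβ, expFeature_mul_expFeature hβ, abs_mul, abs_mul, abs_of_nonneg (by positivity),
      Finset.abs_prod, Finset.abs_prod]
  simp only [h]
  exact sum_expFeature_mul_expFeature hβ n _ _

/-- The feature products are absolutely summable over all indices. -/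
theorem summable_expFeature_mul_expFeature {β : ℝ} (hβ : 0 ≤ β) (w w' : Fin p → ℝ) :
    Summable fun q : ExpIdx p => expFeature β q w * expFeature β q w' := by
  refine Summable.of_norm ?_
  simp only [Real.norm_eq_abs]
  refine (summable_sigma_of_nonneg fun q => abs_nonneg _).2 ⟨fun n => ?_, ?_⟩
  · exact (hasSum_fintype _).summable
  · simp only [tsum_fintype, sum_abs_expFeature_mul_expFeature hβ]
    exact Real.summable_pow_div_factorial _

/-- ★ **The feature lift of the exponential kernel**: `Σ_q φ_q(w) φ_q(w′) = exp(β⟨w, w′⟩)` (`β ≥ 0`), as a `HasSum` over the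
countable index type `ExpIdx p`. -/
theorem hasSum_expFeature_mul_expFeature {β : ℝ} (hβ : 0 ≤ β) (w w' : Fin p → ℝ) :
    HasSum (fun q : ExpIdx p => expFeature β q w * expFeature β q w') (Real.exp (β * ∑ j, w j * w' j)) := by
  have houter : HasSum (fun n : ℕ => (β * ∑ j, w j * w' j) ^ n / (n.factorial : ℝ)) (Real.exp (β * ∑ j, w j * w' j)) := by
    have h := NormedSpace.expSeries_div_hasSum_exp (β * ∑ j, w j * w' j)
    rwa [← Real.exp_eq_exp_ℝ] at h
  refine houter.sigma_of_hasSum (fun n => ?_) (summable_expFeature_mul_expFeature hβ w w')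
  rw [← sum_expFeature_mul_expFeature hβ n w w']
  exact hasSum_fintype _

/-- The squares of the features sum to `exp(β|w|²)`. -/
theorem hasSum_expFeature_sq {β : ℝ} (hβ : 0 ≤ β) (w : Fin p → ℝ) :
    HasSum (fun q : ExpIdx p => expFeature β q w ^ 2) (Real.exp (β * ∑ j, w j ^ 2)) := by
  have h := hasSum_expFeature_mul_expFeature hβ w w
  simp only [← sq] at h
  exact h

/-- A bound on the total feature mass: `Σ_q φ_q(w)² ≤ exp(β p M²)` when `|w_j| ≤ M`. -/
theorem tsum_expFeature_sq_le {β : ℝ} (hβ : 0 ≤ β) {w : Fin p → ℝ} {M : ℝ} (hM : ∀ j, |w j| ≤ M) :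
    ∑' q : ExpIdx p, expFeature β q w ^ 2 ≤ Real.exp (β * (p * M ^ 2)) := by
  rw [(hasSum_expFeature_sq hβ w).tsum_eq]
  refine Real.exp_le_exp.2 (mul_le_mul_of_nonneg_left ?_ hβ)
  calc ∑ j, w j ^ 2 ≤ ∑ _j : Fin p, M ^ 2 := Finset.sum_le_sum fun j _ => by
        rw [← sq_abs]; exact pow_le_pow_left₀ (abs_nonneg _) (hM j) 2
    _ = p * M ^ 2 := by simp

/-- Each feature is a continuous (polynomial) function of `w`. -/
theorem continuous_expFeature (β : ℝ) (q : ExpIdx p) : Continuous fun w : Fin p → ℝ => expFeature β q w := by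
  unfold expFeature
  fun_prop

/-- A bound on one feature: `|φ_{n,i}(w)| ≤ (βⁿ/n!)^{1/2} Mⁿ` when `|w_j| ≤ M`. -/
theorem abs_expFeature_le {β : ℝ} (q : ExpIdx p) {w : Fin p → ℝ} {M : ℝ} (hM : ∀ j, |w j| ≤ M) :
    |expFeature β q w| ≤ Real.sqrt (β ^ q.1 / (q.1.factorial : ℝ)) * M ^ q.1 := by
  unfold expFeature
  rw [abs_mul, abs_of_nonneg (Real.sqrt_nonneg _), Finset.abs_prod]
  refine mul_le_mul_of_nonneg_left ?_ (Real.sqrt_nonneg _)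
  calc ∏ k, |w (q.2 k)| ≤ ∏ _k : Fin q.1, M := Finset.prod_le_prod (fun _ _ => abs_nonneg _) fun k _ => hM _
    _ = M ^ q.1 := by simp

end FeatureLift

end Summit.QuantumFields.YangMills.Cruxes.DiagonalMirrorRPR.SignTwistedDiagonalTrace.WilsonDiagonal

end
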